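import Literature.MathematicalPhysics.QuantumFieldTheory.Balaban1983to89.T4TermwiseBudget

/-!
# TermwiseResidualWitness — leaf S.5 (R-w)(W-w) of the ROUND-2 skeleton of road P1 (term-wise) for row NE7, SPLIT IN
# KERNEL (file 1∕2: ONE TERM): the two-run log-ratio `D(t) = Σ_{X ∈ wfac} (c_B(t,X) − c_A(t,X))` of a product of
# field-independent step constants over a ledger of localisation domains is within `vol·(t-shape + τ-shape)` of ONE
# reference constant — by a t-BRACKET (size ∕ rate crossover on the sub-ledger meeting the observable's support) plus a
# τ-BRACKET (two-run rate on the I-3 window); file 2∕2 `TermwiseResidualWitnessLedger` PRODUCES the END's five binders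

Cell `pub-balaban`, rung (B)+1 sub-cell t4, lineage `b2b-balaban-t4-ne7-p1` (node U5 = NE7, TERM-WISE member;
generation 19), skeleton `HOME/t4/b2b-balaban-t4-ne7-p1-g18/SKELETON-NE7-P1.md` v1.6 §2 leaf S.5 + §3 (w9), record
`t4/T4-EST-NE7-P1.md` §25.  HONEST FRAMING (page 1): FIXED FINITE T⁴, rung (B)+1 = the `ε → 0` limit of unit-scale
averaged expectations, CONDITIONAL on BetaPertH and the nine spine estimates (0/9 proved); NOT infinite volume, NOT a
mass gap, NOT the Clay problem.  NE7 is NOT PRINTED in [Balaban1984PropagatorsI]–[Balaban1989LargeFieldII] and NOT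
proved here.  Every estimate below is a HYPOTHESIS BINDER named in the statement; the theorems are [folklore]
finite-sum algebra and the lineage's crossover devices consumed BY NAME (`T4TermwiseBudget.sliceMin_le_eShape`,
`T4GoodClassBudget.sum_rate_le_windowSum`).  No definitions, no cite tags; nothing printed is asserted.

WHY (record §25 (25a)).  The gen-17 END `TermwiseLocal.goodClause_summable_UN_levels_of_thm1At` (p204490) carries the
RESIDUAL-PROPER factor `w` of a good term — what is left after the E-, boundary, one-sided, 𝐑- and action kinds:
(t, τ)-dependent vacuum-energy normalisations ⊕ the observable's terms at `U = 1` ⊕ the pending factor at trivial outer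
field — through five binders (TermwiseLocalThm1Ledger.lean l.237–244): positivity `hwpos`, a log-ratio radius about a
(t, τ)-dependent centre `hRw`∕`hRRw`∕`hrw`, and AT THE REFERENCE WITNESS a log-ratio within `vol·sw_K` of ONE constant
`c₀ K`, `hWw`∕`hsw`.  The skeleton listed S.5 as OWN-OPEN («a piece of NE7, declared») with a typed ATTACK (v1.3):
by [Balaban1988Convergent] (2.23) p. 258 the effective action is EXACTLY `−A(g_k^{−2}, U_k) + 𝐄_k(U_k) + 𝐑_k(U_k) +
𝐁_k(U_k, A) − E_k` (p. 259 «This expression is fully renormalized, i.e. vacuum energy and coupling constant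
renormalization counterterms are included into it»), so under a format that books every FIELD-DEPENDENT factor into the
five kinds the residual-proper factor is a product of FIELD-INDEPENDENT step constants over localisation domains (the
vacuum-energy counterterms and normalisation constants: p. 264 «Finally, the vacuum energy counterterm E_k, except the
terms logarithmic in coupling constants, has the same bound as above [(2.48)], only with a different constant»;
[Balaban1989LargeFieldII] p. 380 «Similar bounds hold for vacuum energy counterterms and normalization constants, except
that for the last we have the corresponding constant O(log g_j^{−2}) instead of O(1)»), and its two-run log-ratio is
centred on one constant by the split
`D(t) − c₀ = Σ_{X ∈ wf} [(c_B − c_A)(t) − (c_B − c_A)(0)](X) + (Σ_{X ∈ wf} − Σ_{X ∈ wf₀}) (c_B − c_A)(0)(X)`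
(`wf` the term's ledger, `wf₀` the reference = all-small-field term's ledger):
(W-t) the t-BRACKET is supported on the sub-ledger `nf` of domains MEETING THE OBSERVABLE'S SUPPORT (off it the step
      constants do not see `t`: input (W-loc)) and is bounded slice by slice by the MINIMUM of a one-run SIZE
      `Σ_{scale = j} (|c_A(t) − c_A(0)| + |c_B(t) − c_B(0)|) ≤ vol·Ew·a^{K−j}` ((2.48)-TYPE per slice under H2's extended
      format with the observable — print has no observable: [Balaban1989LargeFieldII] p. 356 defers «expectation values
      of physical observables, like loop variables, averaged loop variables» — a HYPOTHESIS SHAPE, input (W-size)) and a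
      two-run RATE `|(c_B(t) − c_B(0)) − (c_A(t) − c_A(0))|(X) ≤ CrW·θ^{scale X}·wt X` (row NE5's step-map closeness at the
      trivial background as a function of `t` — the NAMED ASK of row NE5, journal l.4888; input (W-rate-t)), summed with
      the near-support multiplicity `CF` (input (W-mult-F), [geom]) — `T4TermwiseBudget.sliceMin_le_eShape` BY NAME ⇒
      `≤ vol·max(CF,1)·(Ew + CrW)·Σ_{j+n=K} min(aⁿ, θ^j Λⁿ)`;
(W-τ) the τ-BRACKET: `wf` and `wf₀` DIFFER ONLY AT WINDOW LEVELS `scale ≥ j⋆` (input (W-win) = the DEFINITION of the I-3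
      good class: below the window every good history is the all-small one — [data]), every step constant's two-run
      difference at `t = 0` has the rate `CrW·θ^{scale}·wt` (input (W-rate-0), row NE5 at `U = 1`), both ledgers have
      multiplicity `Cw` ((0.26)-type, input (W-mult)) — `T4GoodClassBudget.sum_rate_le_windowSum` BY NAME on the two set
      differences ⇒ `≤ 2·CrW·Cw·vol·windowSum θ Λ j⋆ K`.
So after files 1–2 S.5 ⇐ (W-fmt) [dict] over NODE O∕F + (W-loc)(W-win) [data] + (W-mult-F)(W-mult) [geom] + (W-size)
HYPOTHESIS SHAPE (one-run, (2.48)-type under H2) + (W-rate-t)(W-rate-0) ROW NE5 (named ask) + bookkeeping — the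
standing leaf S.4 reached in generation 18 (`TermwiseCouplingMismatch`).  Whether (W-size) counts as «located» or
«own-open» is t4-ref2's to grade; it is displayed either way.

WHAT IS PROVED ([folklore]).
§1 `sum_filter_slice_abs_le`, **`tBracket_le`** (W-t), `windowMultiplicity_sdiff`, **`tauBracket_le`** (W-τ),
   **`witness_centring_le`** (both: `|D(t) − c₀| ≤ vol·(max(CF,1)·(Ew + CrW)·Σ_{j+n=K} min(aⁿ, θ^jΛⁿ) + 2·CrW·Cw·windowSum
   θ Λ j⋆ K)`).
§2 `toy_witness_centring` — §1's hypotheses DISCHARGED on explicit data (two domains: one near-support, one window) on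
   which the two runs DIFFER t- and τ-dependently: the binder set is jointly inhabited and non-degenerate.

NOT DELIVERED: any producer of (W-size)∕(W-rate-t)∕(W-rate-0) for Bałaban's objects (rows NE5∕NE9 at `U = 1`; H2); the
identification of `wf`, `c`, `nf`, `wf₀` with the vacuum-energy counterterms and normalisation constants of (2.23)∕
p. 264∕p. 380 beyond the located sentences (NODE O∕F of the skeleton).  NOT NE7 (spine 0/9 unchanged), NOT summit
progress.
-/

noncomputable section

open Finset
open scoped BigOperators

namespace Summit.QuantumFields.BalabanUV.T4Continuum.TermwiseResidualWitness

open Literature.MathematicalPhysics.QuantumFieldTheory.Balaban1983to89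
open T4GoodClassBudget T4Crossover T4TermwiseBudget
open T4RecentScale (Multiplicity)

/-! ## §1 One term: the t-bracket (crossover near the observable's support) and the τ-bracket (rate on the window) -/

section OneTerm

variable {D : Type*} [DecidableEq D]

omit [DecidableEq D] in
/-- A scale slice of a sub-ledger, in absolute value, is at most the slice of `|·|` over the whole ledger. [folklore] -/
theorem sum_filter_slice_abs_le (wf : Finset D) (p : D → Prop) [DecidablePred p] (sc : D → ℕ) (f : D → ℝ) (j : ℕ) :
    |∑ X ∈ (wf.filter p) with sc X = j, f X| ≤ ∑ X ∈ wf with sc X = j, |f X| := by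
  calc |∑ X ∈ (wf.filter p) with sc X = j, f X| ≤ ∑ X ∈ (wf.filter p) with sc X = j, |f X| := abs_sum_le_sum_abs _ _
    _ ≤ ∑ X ∈ wf with sc X = j, |f X| := by
        refine sum_le_sum_of_subset_of_nonneg (fun X hX => ?_) (fun _ _ _ => abs_nonneg _)
        simp only [mem_filter] at hX ⊢
        exact ⟨hX.1.1, hX.2⟩

/-- **(W-t) THE t-BRACKET.**  A ledger `wf` of domains with scales `≤ K`, t-discrepancies `eA X = c_A(t,X) − c_A(0,X)`,
`eB X = c_B(t,X) − c_B(0,X)` vanishing off the near-support sub-ledger `nf` (W-loc), one-run slice SIZES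
`Σ_{scale = j} (|eA| + |eB|) ≤ vol·Ew·a^{K−j}` (W-size), two-run RATES `|eB X − eA X| ≤ CrW·θ^{scale X}·wt X` on `nf`
(W-rate-t) and near-support multiplicity `Σ_{X ∈ nf, scale = j} wt X ≤ CF·vol·Λ^{K−j}` (W-mult-F):
`|Σ_{X∈wf} (eB X − eA X)| ≤ vol·max(CF,1)·(Ew + CrW)·Σ_{j+n=K} min(aⁿ, θ^jΛⁿ)` — slice by slice the minimum of the size and
the rate branch, `T4TermwiseBudget.sliceMin_le_eShape` BY NAME. [folklore] -/
theorem tBracket_le (wf nf : Finset D) (sc : D → ℕ) (wt eA eB : D → ℝ) {K : ℕ} {vol CF Ew a θ Λ CrW : ℝ}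
    (hvol : 0 ≤ vol) (hEw : 0 ≤ Ew) (ha : 0 ≤ a) (hθ : 0 ≤ θ) (hΛ : 0 ≤ Λ) (hCrW : 0 ≤ CrW)
    (hsc : ∀ X ∈ wf, sc X ≤ K) (hloc : ∀ X ∈ wf, X ∉ nf → eA X = 0 ∧ eB X = 0)
    (hsize : ∀ j ≤ K, ∑ X ∈ wf with sc X = j, (|eA X| + |eB X|) ≤ vol * (Ew * a ^ (K - j)))
    (hrate : ∀ X ∈ wf, X ∈ nf → |eB X - eA X| ≤ CrW * θ ^ sc X * wt X) (hwt : ∀ X ∈ nf, 0 ≤ wt X)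
    (hM : Multiplicity nf sc wt CF vol Λ K) :
    |∑ X ∈ wf, (eB X - eA X)|
      ≤ vol * (max CF 1 * ((Ew + CrW) * ∑ x ∈ antidiagonal K, min (a ^ x.2) (θ ^ x.1 * Λ ^ x.2))) := by
  classical
  set s : Finset D := wf.filter (· ∈ nf) with hs
  -- the sum lives on the near-support sub-ledger
  have hsum : ∑ X ∈ wf, (eB X - eA X) = ∑ X ∈ s, (eB X - eA X) := by
    rw [hs, sum_filter]
    refine sum_congr rfl fun X hX => ?_
    by_cases h : X ∈ nf
    · rw [if_pos h]
    · rw [if_neg h, (hloc X hX h).1, (hloc X hX h).2, sub_zero]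
  -- slice it by scale
  have hmaps : ∀ X ∈ s, sc X ∈ range (K + 1) := fun X hX =>
    mem_range.2 (Nat.lt_succ_of_le (hsc X (mem_filter.1 hX).1))
  have hfib : ∑ X ∈ s, (eB X - eA X) = ∑ j ∈ range (K + 1), ∑ X ∈ s with sc X = j, (eB X - eA X) :=
    (sum_fiberwise_of_maps_to hmaps _).symm
  set sl : ℕ → ℝ := fun j => |∑ X ∈ s with sc X = j, (eB X - eA X)| with hsl
  -- size branch per slice
  have hS : ∀ j ≤ K, sl j ≤ vol * (Ew * a ^ (K - j)) := fun j hj => by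
    calc sl j ≤ ∑ X ∈ wf with sc X = j, |eB X - eA X| := sum_filter_slice_abs_le wf (· ∈ nf) sc _ j
      _ ≤ ∑ X ∈ wf with sc X = j, (|eA X| + |eB X|) :=
          sum_le_sum fun X _ => by
            calc |eB X - eA X| ≤ |eB X| + |eA X| := abs_sub _ _
              _ = |eA X| + |eB X| := add_comm _ _
      _ ≤ vol * (Ew * a ^ (K - j)) := hsize j hj
  -- rate branch per slice
  have hρ : ∀ j ≤ K, sl j ≤ CF * vol * (CrW * θ ^ j * Λ ^ (K - j)) := fun j hj => by
    calc sl j ≤ ∑ X ∈ s with sc X = j, |eB X - eA X| := abs_sum_le_sum_abs _ _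
      _ ≤ ∑ X ∈ s with sc X = j, CrW * θ ^ j * wt X := sum_le_sum fun X hX => by
          have hX' := mem_filter.1 hX
          have hXs := mem_filter.1 hX'.1
          rw [← hX'.2]
          exact hrate X hXs.1 hXs.2
      _ = CrW * θ ^ j * ∑ X ∈ s with sc X = j, wt X := (mul_sum _ _ _).symm
      _ ≤ CrW * θ ^ j * ∑ X ∈ nf with sc X = j, wt X := by
          refine mul_le_mul_of_nonneg_left ?_ (mul_nonneg hCrW (pow_nonneg hθ _))
          refine sum_le_sum_of_subset_of_nonneg (fun X hX => ?_) (fun X hX _ => hwt X (mem_filter.1 hX).1)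
          simp only [hs, mem_filter] at hX ⊢
          exact ⟨hX.1.2, hX.2⟩
      _ ≤ CrW * θ ^ j * (CF * vol * Λ ^ (K - j)) :=
          mul_le_mul_of_nonneg_left (hM j hj) (mul_nonneg hCrW (pow_nonneg hθ _))
      _ = CF * vol * (CrW * θ ^ j * Λ ^ (K - j)) := by ring
  have hmin := sliceMin_le_eShape (S := sl) (ρ := sl) hvol hEw ha hθ hΛ hCrW hS hρ
  rw [hsum, hfib]
  calc |∑ j ∈ range (K + 1), ∑ X ∈ s with sc X = j, (eB X - eA X)| ≤ ∑ j ∈ range (K + 1), sl j :=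
        abs_sum_le_sum_abs _ _
    _ = ∑ j ∈ range (K + 1), min (sl j) (sl j) := sum_congr rfl fun j _ => (min_self _).symm
    _ ≤ vol * (max CF 1 * ((Ew + CrW) * ∑ x ∈ antidiagonal K, min (a ^ x.2) (θ ^ x.1 * Λ ^ x.2))) := hmin

/-- Window multiplicity passes to a sub-ledger when the weights are nonnegative. [folklore] -/
theorem windowMultiplicity_sdiff (wf wg : Finset D) (sc : D → ℕ) (wt : D → ℝ) {Cw vol Λ : ℝ} {jstar K : ℕ}
    (hwt : ∀ X ∈ wf, 0 ≤ wt X) (hM : Multiplicity wf sc wt Cw vol Λ K) :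
    WindowMultiplicity (wf \ wg) sc wt Cw vol Λ jstar K := fun j _ hj =>
  calc ∑ X ∈ (wf \ wg) with sc X = j, wt X ≤ ∑ X ∈ wf with sc X = j, wt X := by
        refine sum_le_sum_of_subset_of_nonneg (fun X hX => ?_) (fun X hX _ => hwt X (mem_filter.1 hX).1)
        simp only [mem_filter, mem_sdiff] at hX ⊢
        exact ⟨hX.1.1, hX.2⟩
    _ ≤ Cw * vol * Λ ^ (K - j) := hM j hj

/-- **(W-τ) THE τ-BRACKET.**  The term's ledger `wf` and the reference ledger `wf₀` carry step-constant two-run differences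
`δ0 X = c_B(0,X) − c_A(0,X)` with the rate `|δ0 X| ≤ CrW·θ^{scale X}·wt X` (W-rate-0); they differ only at WINDOW levels
`scale ≥ j⋆` (W-win); both have multiplicity `Cw` (W-mult): then
`|Σ_{wf} δ0 − Σ_{wf₀} δ0| ≤ 2·CrW·(Cw·vol)·windowSum θ Λ j⋆ K` — `T4GoodClassBudget.sum_rate_le_windowSum` BY NAME on the
two set differences. [folklore] -/
theorem tauBracket_le (wf wf₀ : Finset D) (sc : D → ℕ) (wt δ0 : D → ℝ) {K jstar : ℕ} {vol Cw θ Λ CrW : ℝ}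
    (hθ : 0 ≤ θ) (hCrW : 0 ≤ CrW) (hsc : ∀ X ∈ wf, sc X ≤ K) (hsc₀ : ∀ X ∈ wf₀, sc X ≤ K)
    (hwin : ∀ X ∈ wf, X ∉ wf₀ → jstar ≤ sc X) (hwin₀ : ∀ X ∈ wf₀, X ∉ wf → jstar ≤ sc X)
    (hrate : ∀ X ∈ wf ∪ wf₀, |δ0 X| ≤ CrW * θ ^ sc X * wt X) (hwt : ∀ X ∈ wf ∪ wf₀, 0 ≤ wt X)
    (hM : Multiplicity wf sc wt Cw vol Λ K) (hM₀ : Multiplicity wf₀ sc wt Cw vol Λ K) :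
    |(∑ X ∈ wf, δ0 X) - ∑ X ∈ wf₀, δ0 X| ≤ 2 * (CrW * (Cw * vol) * windowSum θ Λ jstar K) := by
  rw [← sum_sdiff_sub_sum_sdiff]
  have hrec : RecentOnly (wf \ wf₀) sc jstar K := fun X hX =>
    ⟨hwin X (mem_sdiff.1 hX).1 (mem_sdiff.1 hX).2, hsc X (mem_sdiff.1 hX).1⟩
  have hrec₀ : RecentOnly (wf₀ \ wf) sc jstar K := fun X hX =>
    ⟨hwin₀ X (mem_sdiff.1 hX).1 (mem_sdiff.1 hX).2, hsc₀ X (mem_sdiff.1 hX).1⟩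
  have hWM := windowMultiplicity_sdiff wf wf₀ sc wt (jstar := jstar)
    (fun X hX => hwt X (mem_union_left _ hX)) hM
  have hWM₀ := windowMultiplicity_sdiff wf₀ wf sc wt (jstar := jstar)
    (fun X hX => hwt X (mem_union_right _ hX)) hM₀
  have b1 : |∑ X ∈ wf \ wf₀, δ0 X| ≤ CrW * (Cw * vol) * windowSum θ Λ jstar K :=
    calc |∑ X ∈ wf \ wf₀, δ0 X| ≤ ∑ X ∈ wf \ wf₀, |δ0 X| := abs_sum_le_sum_abs _ _
      _ ≤ ∑ X ∈ wf \ wf₀, CrW * θ ^ sc X * wt X :=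
          sum_le_sum fun X hX => hrate X (mem_union_left _ (mem_sdiff.1 hX).1)
      _ ≤ CrW * (Cw * vol) * windowSum θ Λ jstar K := sum_rate_le_windowSum hCrW hθ hrec hWM
  have b2 : |∑ X ∈ wf₀ \ wf, δ0 X| ≤ CrW * (Cw * vol) * windowSum θ Λ jstar K :=
    calc |∑ X ∈ wf₀ \ wf, δ0 X| ≤ ∑ X ∈ wf₀ \ wf, |δ0 X| := abs_sum_le_sum_abs _ _
      _ ≤ ∑ X ∈ wf₀ \ wf, CrW * θ ^ sc X * wt X :=
          sum_le_sum fun X hX => hrate X (mem_union_right _ (mem_sdiff.1 hX).1)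
      _ ≤ CrW * (Cw * vol) * windowSum θ Λ jstar K := sum_rate_le_windowSum hCrW hθ hrec₀ hWM₀
  calc |(∑ X ∈ wf \ wf₀, δ0 X) - ∑ X ∈ wf₀ \ wf, δ0 X| ≤ |∑ X ∈ wf \ wf₀, δ0 X| + |∑ X ∈ wf₀ \ wf, δ0 X| :=
        abs_sub _ _
    _ ≤ _ := by linarith

/-- **BOTH BRACKETS: THE WITNESS CENTRING OF ONE TERM.**  With `D(t) = Σ_{X∈wf} (c_B(t,X) − c_A(t,X))` and the reference
constant `c₀ = Σ_{X∈wf₀} (c_B(0,X) − c_A(0,X))`: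
`|D(t) − c₀| ≤ vol·( max(CF,1)·(Ew + CrW)·Σ_{j+n=K} min(aⁿ, θ^jΛⁿ) + 2·CrW·Cw·windowSum θ Λ j⋆ K )`. [folklore] -/
theorem witness_centring_le (wf wf₀ nf : Finset D) (sc : D → ℕ) (wt : D → ℝ) (cAt cBt cA0 cB0 : D → ℝ)
    {K jstar : ℕ} {vol CF Cw Ew a θ Λ CrW : ℝ}
    (hvol : 0 ≤ vol) (hEw : 0 ≤ Ew) (ha : 0 ≤ a) (hθ : 0 ≤ θ) (hΛ : 0 ≤ Λ) (hCrW : 0 ≤ CrW)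
    (hsc : ∀ X ∈ wf, sc X ≤ K) (hsc₀ : ∀ X ∈ wf₀, sc X ≤ K)
    (hloc : ∀ X ∈ wf, X ∉ nf → cAt X = cA0 X ∧ cBt X = cB0 X)
    (hsize : ∀ j ≤ K, ∑ X ∈ wf with sc X = j, (|cAt X - cA0 X| + |cBt X - cB0 X|) ≤ vol * (Ew * a ^ (K - j)))
    (hratet : ∀ X ∈ wf, X ∈ nf → |(cBt X - cB0 X) - (cAt X - cA0 X)| ≤ CrW * θ ^ sc X * wt X)
    (hwtF : ∀ X ∈ nf, 0 ≤ wt X) (hMF : Multiplicity nf sc wt CF vol Λ K)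
    (hwin : ∀ X ∈ wf, X ∉ wf₀ → jstar ≤ sc X) (hwin₀ : ∀ X ∈ wf₀, X ∉ wf → jstar ≤ sc X)
    (hrate0 : ∀ X ∈ wf ∪ wf₀, |cB0 X - cA0 X| ≤ CrW * θ ^ sc X * wt X) (hwt : ∀ X ∈ wf ∪ wf₀, 0 ≤ wt X)
    (hM : Multiplicity wf sc wt Cw vol Λ K) (hM₀ : Multiplicity wf₀ sc wt Cw vol Λ K) :
    |(∑ X ∈ wf, (cBt X - cAt X)) - ∑ X ∈ wf₀, (cB0 X - cA0 X)|
      ≤ vol * (max CF 1 * ((Ew + CrW) * ∑ x ∈ antidiagonal K, min (a ^ x.2) (θ ^ x.1 * Λ ^ x.2))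
          + 2 * (CrW * Cw * windowSum θ Λ jstar K)) := by
  have e : (∑ X ∈ wf, (cBt X - cAt X)) - ∑ X ∈ wf₀, (cB0 X - cA0 X)
      = (∑ X ∈ wf, ((cBt X - cB0 X) - (cAt X - cA0 X))) + ((∑ X ∈ wf, (cB0 X - cA0 X)) - ∑ X ∈ wf₀, (cB0 X - cA0 X)) := by
    rw [← add_sub_assoc, ← sum_add_distrib]
    congr 1
    exact sum_congr rfl fun X _ => by ring
  have h1 := tBracket_le wf nf sc wt (fun X => cAt X - cA0 X) (fun X => cBt X - cB0 X) hvol hEw ha hθ hΛ hCrW hsc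
    (fun X hX hXn => by
      refine ⟨?_, ?_⟩ <;> simp only [(hloc X hX hXn).1, (hloc X hX hXn).2, sub_self]) hsize hratet hwtF hMF
  have h2 := tauBracket_le wf wf₀ sc wt (fun X => cB0 X - cA0 X) hθ hCrW hsc hsc₀ hwin hwin₀ hrate0 hwt hM hM₀
  rw [e]
  calc |(∑ X ∈ wf, ((cBt X - cB0 X) - (cAt X - cA0 X)))
          + ((∑ X ∈ wf, (cB0 X - cA0 X)) - ∑ X ∈ wf₀, (cB0 X - cA0 X))|
        ≤ |∑ X ∈ wf, ((cBt X - cB0 X) - (cAt X - cA0 X))|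
          + |(∑ X ∈ wf, (cB0 X - cA0 X)) - ∑ X ∈ wf₀, (cB0 X - cA0 X)| := abs_add_le _ _
    _ ≤ vol * (max CF 1 * ((Ew + CrW) * ∑ x ∈ antidiagonal K, min (a ^ x.2) (θ ^ x.1 * Λ ^ x.2)))
          + 2 * (CrW * (Cw * vol) * windowSum θ Λ jstar K) := add_le_add h1 h2
    _ = _ := by ring

end OneTerm

/-! ## §2 Non-vacuity: the inputs jointly inhabited with a t-dependent, τ-dependent ledger on which the two runs differ -/

section Toy

/-- TOY INSTANCE OF `witness_centring_le` (every hypothesis DISCHARGED in kernel, so the binder set is jointly inhabited):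
two domains `0, 1 : Fin 2` at the top scale (`sc ≡ 1 = K`), weights `wt ≡ 1`; term ledger `wf = {0, 1}`, reference
ledger `wf₀ = {0}` (they differ at the WINDOW domain `1`, window `j⋆ = 1`), near-support sub-ledger `nf = {0}`; run A's
constants vanish; run B's constants are `1` on both domains at `t = 1`, and at `t = 0` they are `0` on domain `0` and `1`
on domain `1` — so the t-discrepancy (`= 1`) lives on the near-support domain `0` only ((W-loc) holds at `1`) and the
τ-discrepancy (`= 1`) on the window domain `1`.  Constants `vol = 1`, `CF = Cw = 2`, `Ew = 1`, `a = 1/2`, `θ = Λ = 1`,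
`CrW = 1`.  Then `D(1) − c₀ = 2 − 0 = 2` (the two runs DIFFER, t- and τ-dependently) and §1's bound holds for these data
(it evaluates to `1·(2·(2·(1/2 + 1)) + 2·(2·1)) = 10`). [folklore] -/
theorem toy_witness_centring :
    |(∑ X ∈ ({0, 1} : Finset (Fin 2)), ((fun _ => (1 : ℝ)) X - (fun _ => (0 : ℝ)) X))
        - ∑ X ∈ ({0} : Finset (Fin 2)), ((fun X => if X = 1 then (1 : ℝ) else 0) X - (fun _ => (0 : ℝ)) X)| = 2 ∧
    |(∑ X ∈ ({0, 1} : Finset (Fin 2)), ((fun _ => (1 : ℝ)) X - (fun _ => (0 : ℝ)) X))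
        - ∑ X ∈ ({0} : Finset (Fin 2)), ((fun X => if X = 1 then (1 : ℝ) else 0) X - (fun _ => (0 : ℝ)) X)|
      ≤ 1 * (max 2 1 * ((1 + 1) * ∑ x ∈ antidiagonal 1, min ((1 / 2 : ℝ) ^ x.2) (1 ^ x.1 * 1 ^ x.2))
          + 2 * (1 * 2 * windowSum 1 1 1 1)) := by
  refine ⟨?_, ?_⟩
  · simp [Finset.sum_pair (show (0 : Fin 2) ≠ 1 by decide)]
    norm_num
  · have hsl : ∀ (s : Finset (Fin 2)) (f : Fin 2 → ℝ) (j : ℕ), j ≤ 1 →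
        ∑ X ∈ s with (fun _ : Fin 2 => 1) X = j, f X = if j = 1 then ∑ X ∈ s, f X else 0 := by
      intro s f j hj
      interval_cases j
      · rw [if_neg (by decide), Finset.filter_false_of_mem (fun _ _ => by simp), sum_empty]
      · rw [if_pos rfl, Finset.filter_true_of_mem (fun _ _ => rfl)]
    refine witness_centring_le (D := Fin 2) ({0, 1} : Finset (Fin 2)) {0} {0} (fun _ => 1) (fun _ => (1 : ℝ))
      (fun _ => (0 : ℝ)) (fun _ => (1 : ℝ)) (fun _ => (0 : ℝ)) (fun X => if X = 1 then (1 : ℝ) else 0)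
      (K := 1) (jstar := 1) (vol := 1) (CF := 2) (Cw := 2) (Ew := 1) (a := 1 / 2) (θ := 1) (Λ := 1) (CrW := 1)
      zero_le_one zero_le_one (by norm_num) zero_le_one zero_le_one zero_le_one (fun _ _ => le_rfl) (fun _ _ => le_rfl)
      ?_ ?_ ?_ (fun _ _ => zero_le_one) ?_ ?_ ?_ ?_ (fun _ _ => zero_le_one) ?_ ?_
    · -- (W-loc): off `nf = {0}` (i.e. at `1`) no t-dependence
      intro X hX hXn
      fin_cases X <;> simp_all
    · -- (W-size)
      intro j hj
      rw [hsl _ _ j hj]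
      split_ifs with h
      · subst h
        simp [Finset.sum_pair (show (0 : Fin 2) ≠ 1 by decide)]
      · have : (0 : ℝ) ≤ 1 * (1 * (1 / 2) ^ (1 - j)) := by positivity
        exact this
    · -- (W-rate-t) on `nf`
      intro X hX hXn
      simp only [Finset.mem_singleton] at hXn
      subst hXn
      norm_num
    · -- (W-mult-F)
      intro j hj
      rw [hsl _ _ j hj]
      split_ifs <;> norm_num
    · -- (W-win)
      intro X _ _
      exact le_rfl
    · intro X _ _
      exact le_rfl
    · -- (W-rate-0)
      intro X hX
      fin_cases X <;> norm_num
    · -- (W-mult) on `wf`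
      intro j hj
      rw [hsl _ _ j hj]
      split_ifs <;> norm_num [Finset.sum_pair (show (0 : Fin 2) ≠ 1 by decide)]
    · -- (W-mult) on `wf₀`
      intro j hj
      rw [hsl _ _ j hj]
      split_ifs <;> norm_num

end Toy

end Summit.QuantumFields.BalabanUV.T4Continuum.TermwiseResidualWitness
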